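import Mathlib

/-!
# Route EIHFluxBalance — `ModulatedKerrHandoff`, stub `stub_dragDefect`: the affine-drag Taylor
# remainders to second order

Helper file for the crux `stmt-FinalStateConjecture-10167`
(`Summit.FinalStateConjecture.FinalStateConjecture.Theses.EIHFluxBalance.ModulatedKerrHandoff`),
line `overlap-modulation-second-iterate`, stub `stub_dragDefect`.

The drag-corrected superposition contains the FIRST-ORDER Lie drag `Dh(y)[Ay] + h(A·,·) + h(·,A·)`
of the field `h` of hole 1 along the linear vector field `X(y) = Ay`, while the exactly Ricci-flat
comparison field is the affine pull-back `(1 + A)ᵀ h((1 + A)y) (1 + A)`. Their difference is made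
of the Taylor remainders of the scalar components `ψ(y) = h(y)(v, w)` along the affine map
`y ↦ y + Ay`:

* the second-order remainder `S(y) = ψ(y + Ay) − ψ(y) − Dψ(y)[Ay]`,
* the first-order remainder `Δ(y) = ψ(y + Ay) − ψ(y)`, and the composite `ψ(y + Ay)`,

and the defect estimate needs their jets of order `≤ 2` at a point `x` to be of the sizes
`‖A x‖² · sup ‖D^{k+2}ψ‖ + …`, i.e. quadratic in `A`. This file is that pure calculus on a real
normed space `E` (values in a normed space `G`): for `ψ` smooth on an open convex set `U ∋ x, x + Ax`
with `‖Dᵏψ‖ ≤ Cₖ` on `U` (`k ≤ 4`),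

* `norm_taylor₂_le` — `‖g(x + w) − g(x) − Dg(x)w‖ ≤ C ‖w‖²` when `‖D²g‖ ≤ C` on `U`;
* `hasFDerivAt_rem` — the first derivative of `S` in closed form (`HasFDerivAt.clm_apply` for
  `y ↦ Dψ(y)[Ay]`), and the bounds `norm_rem_le`, `norm_fderiv_rem_le`:
  `‖S(x)‖ ≤ C₂‖Ax‖²`, `‖DS(x)‖ ≤ C₃‖Ax‖² + C₂‖A‖‖Ax‖` (the cancellation uses the symmetry of
  `D²ψ`, `ContDiffAt.isSymmSndFDerivAt`); the symmetries of `D³ψ` (`fderiv₃_symm₁₂`,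
  `fderiv₃_symm₂₃`, `fderiv₃_cycle`) for the second derivatives (companion file `…TaylorSecond`);
* the same for `Δ` (`norm_delta_le`, `norm_fderiv_delta_le`) and for `ψ(· + A·)`
  (`norm_fderiv_comp_affine_le`).

Elementary (Dieudonné 1960, (8.6.2), (8.12.2), (8.14.3)); no definitions.
-/

noncomputable section

-- `Summit.<S>.<S>.…` (single-problem summit, D-0017) trips core's duplicate-namespace linter.
set_option linter.dupNamespace false
-- nested operator spaces `E →L E →L E →L G`
set_option maxSynthPendingDepth 3

open Set Filter ContinuousLinearMap
open scoped Topology ContDiff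

namespace Summit.FinalStateConjecture.FinalStateConjecture.Theorems

namespace DragDefect

variable {E G : Type*} [NormedAddCommGroup E] [NormedSpace ℝ E] [NormedAddCommGroup G]
  [NormedSpace ℝ G]

/-! ### Mean value and second-order Taylor inequalities on a convex open set -/

/-- Points of the segment `[x, x + w]` are within `‖w‖` of `x`. [folklore] -/
theorem norm_sub_le_of_mem_segment {x w z : E} (hz : z ∈ segment ℝ x (x + w)) : ‖z - x‖ ≤ ‖w‖ := by
  rw [segment_eq_image'] at hz
  obtain ⟨t, ht, rfl⟩ := hz
  rw [add_sub_cancel_left, add_sub_cancel_left, norm_smul, Real.norm_eq_abs, abs_of_nonneg ht.1]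
  exact mul_le_of_le_one_left (norm_nonneg w) ht.2

/-- **Mean value inequality**: `‖g(x + w) − g(x)‖ ≤ C‖w‖` if `‖Dg‖ ≤ C` on a convex set
containing `x` and `x + w` on which `g` is differentiable. [folklore] -/
theorem norm_sub_le_of_fderiv {g : E → G} {U : Set E} (hU : Convex ℝ U)
    (hd : ∀ z ∈ U, DifferentiableAt ℝ g z) {C : ℝ} (hC : ∀ z ∈ U, ‖fderiv ℝ g z‖ ≤ C) {x w : E}
    (hx : x ∈ U) (hxw : x + w ∈ U) : ‖g (x + w) - g x‖ ≤ C * ‖w‖ := by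
  have h := hU.norm_image_sub_le_of_norm_fderiv_le hd hC hx hxw
  rwa [add_sub_cancel_left] at h

/-- **Second-order Taylor inequality**: `‖g(x + w) − g(x) − Dg(x)w‖ ≤ C‖w‖²` if `Dg` is
differentiable with `‖D(Dg)‖ ≤ C` on a convex set `U ∋ x, x + w` on which `g` is differentiable
(mean value inequality on the segment for `y ↦ g(y) − Dg(x)(y − x)`, whose derivative
`Dg(y) − Dg(x)` is `≤ C‖w‖` there by the mean value inequality for `Dg`). [folklore] -/
theorem norm_taylor₂_le {g : E → G} {U : Set E} (hU : Convex ℝ U)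
    (hd : ∀ z ∈ U, DifferentiableAt ℝ g z) (hd2 : ∀ z ∈ U, DifferentiableAt ℝ (fderiv ℝ g) z)
    {C : ℝ} (hC : ∀ z ∈ U, ‖fderiv ℝ (fderiv ℝ g) z‖ ≤ C) {x w : E} (hx : x ∈ U)
    (hxw : x + w ∈ U) : ‖g (x + w) - g x - fderiv ℝ g x w‖ ≤ C * ‖w‖ ^ 2 := by
  have hseg : segment ℝ x (x + w) ⊆ U := hU.segment_subset hx hxw
  have hderiv : ∀ z ∈ segment ℝ x (x + w),
      HasFDerivWithinAt g (fderiv ℝ g z) (segment ℝ x (x + w)) z :=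
    fun z hz ↦ (hd z (hseg hz)).hasFDerivAt.hasFDerivWithinAt
  have hbound : ∀ z ∈ segment ℝ x (x + w), ‖fderiv ℝ g z - fderiv ℝ g x‖ ≤ C * ‖w‖ := by
    intro z hz
    have h1 : ‖fderiv ℝ g (x + (z - x)) - fderiv ℝ g x‖ ≤ C * ‖z - x‖ :=
      norm_sub_le_of_fderiv hU hd2 hC hx (by rw [add_sub_cancel]; exact hseg hz)
    rw [add_sub_cancel] at h1
    have hC0 : 0 ≤ C := by
      have := hC x hx
      exact (norm_nonneg _).trans this
    exact h1.trans (mul_le_mul_of_nonneg_left (norm_sub_le_of_mem_segment hz) hC0)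
  have h := (convex_segment x (x + w)).norm_image_sub_le_of_norm_hasFDerivWithin_le' hderiv hbound
    (left_mem_segment ℝ x (x + w)) (right_mem_segment ℝ x (x + w))
  rw [add_sub_cancel_left] at h
  calc _ ≤ C * ‖w‖ * ‖w‖ := h
    _ = C * ‖w‖ ^ 2 := by ring

/-! ### Smoothness bookkeeping on an open set -/

section Smooth

variable {ψ : E → G} {U : Set E} {z : E}

/-- `ψ` is `C^∞` at the points of the open set `U`. [folklore] -/
theorem contDiffAt_of_mem (hUo : IsOpen U) (hψ : ContDiffOn ℝ ∞ ψ U) (hz : z ∈ U) :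
    ContDiffAt ℝ ∞ ψ z := (hψ z hz).contDiffAt (hUo.mem_nhds hz)

/-- `Dψ` is `C^∞` on the open set `U`. [folklore] -/
theorem contDiffOn_fderiv_of_isOpen (hUo : IsOpen U) (hψ : ContDiffOn ℝ ∞ ψ U) :
    ContDiffOn ℝ ∞ (fderiv ℝ ψ) U := hψ.fderiv_of_isOpen hUo (by simp)

/-- `ψ` is differentiable at the points of `U`. [folklore] -/
theorem differentiableAt_of_mem (hUo : IsOpen U) (hψ : ContDiffOn ℝ ∞ ψ U) (hz : z ∈ U) :
    DifferentiableAt ℝ ψ z := (contDiffAt_of_mem hUo hψ hz).differentiableAt (by simp)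

/-- `Dψ` has derivative `D(Dψ)(z)` at the points of `U`. [folklore] -/
theorem hasFDerivAt_fderiv_of_mem (hUo : IsOpen U) (hψ : ContDiffOn ℝ ∞ ψ U) (hz : z ∈ U) :
    HasFDerivAt (fderiv ℝ ψ) (fderiv ℝ (fderiv ℝ ψ) z) z :=
  (differentiableAt_of_mem hUo (contDiffOn_fderiv_of_isOpen hUo hψ) hz).hasFDerivAt

/-- `D²ψ(z)` is symmetric at the points of `U`. [folklore] -/
theorem fderiv_fderiv_symm (hUo : IsOpen U) (hψ : ContDiffOn ℝ ∞ ψ U) (hz : z ∈ U) (v w : E) :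
    fderiv ℝ (fderiv ℝ ψ) z v w = fderiv ℝ (fderiv ℝ ψ) z w v :=
  (contDiffAt_of_mem hUo hψ hz).isSymmSndFDerivAt (by
    rw [minSmoothness_of_isRCLikeNormedField]; exact WithTop.coe_le_coe.mpr le_top) v w

/-- `∂_v (D²ψ(·)(u)(w))(z) = D³ψ(z)(v)(u)(w)`. [folklore] -/
theorem fderiv_fderiv_fderiv_apply₂ (hUo : IsOpen U) (hψ : ContDiffOn ℝ ∞ ψ U) (hz : z ∈ U)
    (u w v : E) :
    fderiv ℝ (fun y ↦ fderiv ℝ (fderiv ℝ ψ) y u w) z v =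
      fderiv ℝ (fderiv ℝ (fderiv ℝ ψ)) z v u w := by
  have hD : DifferentiableAt ℝ (fderiv ℝ (fderiv ℝ ψ)) z :=
    differentiableAt_of_mem hUo (contDiffOn_fderiv_of_isOpen hUo
      (contDiffOn_fderiv_of_isOpen hUo hψ)) hz
  have h1 : DifferentiableAt ℝ (fun y ↦ fderiv ℝ (fderiv ℝ ψ) y u) z := hD.clm_apply
    (differentiableAt_const u)
  rw [fderiv_clm_apply h1 (differentiableAt_const w), fderiv_clm_apply hD (differentiableAt_const u)]
  simp

/-- **`D³ψ(z)` is symmetric in its last two slots** (differentiate the symmetry of `D²ψ` near `z`).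
[folklore] -/
theorem fderiv₃_symm₂₃ (hUo : IsOpen U) (hψ : ContDiffOn ℝ ∞ ψ U) (hz : z ∈ U) (v u w : E) :
    fderiv ℝ (fderiv ℝ (fderiv ℝ ψ)) z v u w = fderiv ℝ (fderiv ℝ (fderiv ℝ ψ)) z v w u := by
  rw [← fderiv_fderiv_fderiv_apply₂ hUo hψ hz, ← fderiv_fderiv_fderiv_apply₂ hUo hψ hz]
  have heq : (fun y ↦ fderiv ℝ (fderiv ℝ ψ) y u w) =ᶠ[𝓝 z] fun y ↦ fderiv ℝ (fderiv ℝ ψ) y w u :=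
    Filter.eventually_of_mem (hUo.mem_nhds hz) fun y hy ↦ fderiv_fderiv_symm hUo hψ hy u w
  rw [heq.fderiv_eq]

/-- **`D³ψ(z)` is symmetric in its first two slots** (symmetry of the second derivative of `Dψ`).
[folklore] -/
theorem fderiv₃_symm₁₂ (hUo : IsOpen U) (hψ : ContDiffOn ℝ ∞ ψ U) (hz : z ∈ U) (v u : E) :
    fderiv ℝ (fderiv ℝ (fderiv ℝ ψ)) z v u = fderiv ℝ (fderiv ℝ (fderiv ℝ ψ)) z u v :=
  (contDiffAt_of_mem hUo (contDiffOn_fderiv_of_isOpen hUo hψ) hz).isSymmSndFDerivAt (by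
    rw [minSmoothness_of_isRCLikeNormedField]; exact WithTop.coe_le_coe.mpr le_top) v u

/-- `D³ψ(z)(v)(u)(w) = D³ψ(z)(w)(v)(u)` (the cyclic rearrangement used for the Taylor term).
[folklore] -/
theorem fderiv₃_cycle (hUo : IsOpen U) (hψ : ContDiffOn ℝ ∞ ψ U) (hz : z ∈ U) (v u w : E) :
    fderiv ℝ (fderiv ℝ (fderiv ℝ ψ)) z v u w = fderiv ℝ (fderiv ℝ (fderiv ℝ ψ)) z w v u := by
  rw [fderiv₃_symm₂₃ hUo hψ hz v u w]
  have h := fderiv₃_symm₁₂ hUo hψ hz v w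
  rw [h, fderiv₃_symm₂₃ hUo hψ hz w v u]

end Smooth

/-! ### The remainders along the affine map `y ↦ y + Ay` -/

section Remainders

variable {ψ : E → G} {U : Set E} {A : E →L[ℝ] E} {x z : E} {C₀ C₁ C₂ C₃ C₄ : ℝ}

/-- The affine map `y ↦ y + Ay` has derivative `1 + A`. [folklore] -/
theorem hasFDerivAt_affine (A : E →L[ℝ] E) (z : E) :
    HasFDerivAt (fun y : E ↦ y + A y) (ContinuousLinearMap.id ℝ E + A) z :=
  (hasFDerivAt_id z).add A.hasFDerivAt

/-- Chain rule: `D(ψ(· + A·))(z) = Dψ(z + Az) ∘ (1 + A)`. [folklore] -/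
theorem hasFDerivAt_comp_affine (hUo : IsOpen U) (hψ : ContDiffOn ℝ ∞ ψ U) (hAz : z + A z ∈ U) :
    HasFDerivAt (fun y ↦ ψ (y + A y))
      ((fderiv ℝ ψ (z + A z)).comp (ContinuousLinearMap.id ℝ E + A)) z :=
  (differentiableAt_of_mem hUo hψ hAz).hasFDerivAt.comp z (hasFDerivAt_affine A z)

/-- `D(y ↦ Dψ(y)[Ay])(z) = Dψ(z) ∘ A + (D²ψ(z))ᵗ(Az)`. [folklore] -/
theorem hasFDerivAt_fderiv_apply_affine (hUo : IsOpen U) (hψ : ContDiffOn ℝ ∞ ψ U) (hz : z ∈ U) :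
    HasFDerivAt (fun y ↦ fderiv ℝ ψ y (A y))
      ((fderiv ℝ ψ z).comp A + (fderiv ℝ (fderiv ℝ ψ) z).flip (A z)) z :=
  (hasFDerivAt_fderiv_of_mem hUo hψ hz).clm_apply A.hasFDerivAt

/-- **First derivative of the second-order remainder** `S(y) = ψ(y + Ay) − ψ(y) − Dψ(y)[Ay]`:
`DS(z) = Dψ(z + Az) ∘ (1 + A) − Dψ(z) − Dψ(z) ∘ A − (D²ψ(z))ᵗ(Az)` at every `z ∈ U` with
`z + Az ∈ U`. [folklore] -/
theorem hasFDerivAt_rem (hUo : IsOpen U) (hψ : ContDiffOn ℝ ∞ ψ U) (hz : z ∈ U)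
    (hAz : z + A z ∈ U) :
    HasFDerivAt (fun y ↦ ψ (y + A y) - ψ y - fderiv ℝ ψ y (A y))
      ((fderiv ℝ ψ (z + A z)).comp (ContinuousLinearMap.id ℝ E + A) - fderiv ℝ ψ z
        - ((fderiv ℝ ψ z).comp A + (fderiv ℝ (fderiv ℝ ψ) z).flip (A z))) z :=
  ((hasFDerivAt_comp_affine hUo hψ hAz).sub (differentiableAt_of_mem hUo hψ hz).hasFDerivAt).sub
    (hasFDerivAt_fderiv_apply_affine hUo hψ hz)

/-- **First derivative of the first-order remainder** `Δ(y) = ψ(y + Ay) − ψ(y)`: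
`DΔ(z) = Dψ(z + Az) ∘ (1 + A) − Dψ(z)`. [folklore] -/
theorem hasFDerivAt_delta (hUo : IsOpen U) (hψ : ContDiffOn ℝ ∞ ψ U) (hz : z ∈ U)
    (hAz : z + A z ∈ U) :
    HasFDerivAt (fun y ↦ ψ (y + A y) - ψ y)
      ((fderiv ℝ ψ (z + A z)).comp (ContinuousLinearMap.id ℝ E + A) - fderiv ℝ ψ z) z :=
  (hasFDerivAt_comp_affine hUo hψ hAz).sub (differentiableAt_of_mem hUo hψ hz).hasFDerivAt

/-- **`‖S(x)‖ ≤ C₂ ‖Ax‖²`** for `‖D²ψ‖ ≤ C₂` on the convex open `U ∋ x, x + Ax`. [folklore] -/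
theorem norm_rem_le (hUo : IsOpen U) (hUc : Convex ℝ U) (hψ : ContDiffOn ℝ ∞ ψ U) (hx : x ∈ U)
    (hAx : x + A x ∈ U) (h2 : ∀ z ∈ U, ‖fderiv ℝ (fderiv ℝ ψ) z‖ ≤ C₂) :
    ‖ψ (x + A x) - ψ x - fderiv ℝ ψ x (A x)‖ ≤ C₂ * ‖A x‖ ^ 2 :=
  norm_taylor₂_le hUc (fun _ hz ↦ differentiableAt_of_mem hUo hψ hz)
    (fun _ hz ↦ (hasFDerivAt_fderiv_of_mem hUo hψ hz).differentiableAt) h2 hx hAx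

/-- **`‖Δ(x)‖ ≤ C₁ ‖Ax‖`** for `‖Dψ‖ ≤ C₁` on `U`. [folklore] -/
theorem norm_delta_le (hUo : IsOpen U) (hUc : Convex ℝ U) (hψ : ContDiffOn ℝ ∞ ψ U) (hx : x ∈ U)
    (hAx : x + A x ∈ U) (h1 : ∀ z ∈ U, ‖fderiv ℝ ψ z‖ ≤ C₁) :
    ‖ψ (x + A x) - ψ x‖ ≤ C₁ * ‖A x‖ :=
  norm_sub_le_of_fderiv hUc (fun _ hz ↦ differentiableAt_of_mem hUo hψ hz) h1 hx hAx

/-- `‖Dψ(x + Ax) − Dψ(x)‖ ≤ C₂ ‖Ax‖` for `‖D²ψ‖ ≤ C₂` on `U`. [folklore] -/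
theorem norm_fderiv_sub_le (hUo : IsOpen U) (hUc : Convex ℝ U) (hψ : ContDiffOn ℝ ∞ ψ U)
    (hx : x ∈ U) (hAx : x + A x ∈ U) (h2 : ∀ z ∈ U, ‖fderiv ℝ (fderiv ℝ ψ) z‖ ≤ C₂) :
    ‖fderiv ℝ ψ (x + A x) - fderiv ℝ ψ x‖ ≤ C₂ * ‖A x‖ :=
  norm_sub_le_of_fderiv hUc (fun _ hz ↦ (hasFDerivAt_fderiv_of_mem hUo hψ hz).differentiableAt)
    h2 hx hAx

/-- `‖D²ψ(x + Ax) − D²ψ(x)‖ ≤ C₃ ‖Ax‖` for `‖D³ψ‖ ≤ C₃` on `U`. [folklore] -/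
theorem norm_fderiv_fderiv_sub_le (hUo : IsOpen U) (hUc : Convex ℝ U) (hψ : ContDiffOn ℝ ∞ ψ U)
    (hx : x ∈ U) (hAx : x + A x ∈ U)
    (h3 : ∀ z ∈ U, ‖fderiv ℝ (fderiv ℝ (fderiv ℝ ψ)) z‖ ≤ C₃) :
    ‖fderiv ℝ (fderiv ℝ ψ) (x + A x) - fderiv ℝ (fderiv ℝ ψ) x‖ ≤ C₃ * ‖A x‖ :=
  norm_sub_le_of_fderiv hUc
    (fun _ hz ↦ (hasFDerivAt_fderiv_of_mem hUo (contDiffOn_fderiv_of_isOpen hUo hψ)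
      hz).differentiableAt) h3 hx hAx

/-- The Taylor term of `DS`: `(D²ψ(x))ᵗ(Ax) = D(Dψ)(x)(Ax)` by the symmetry of `D²ψ(x)`.
[folklore] -/
theorem fderiv_fderiv_flip_apply (hUo : IsOpen U) (hψ : ContDiffOn ℝ ∞ ψ U) (hx : x ∈ U) (w : E) :
    (fderiv ℝ (fderiv ℝ ψ) x).flip w = fderiv ℝ (fderiv ℝ ψ) x w := by
  ext u
  rw [flip_apply]
  exact fderiv_fderiv_symm hUo hψ hx u w

/-- **`‖DS(x)‖ ≤ C₃ ‖Ax‖² + C₂ ‖A‖ ‖Ax‖`**: `DS(x) = [Dψ(x+Ax) − Dψ(x) − D(Dψ)(x)(Ax)] +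
(Dψ(x+Ax) − Dψ(x)) ∘ A` (second-order Taylor for `Dψ`, mean value for `Dψ`). [folklore] -/
theorem norm_fderiv_rem_le (hUo : IsOpen U) (hUc : Convex ℝ U) (hψ : ContDiffOn ℝ ∞ ψ U)
    (hx : x ∈ U) (hAx : x + A x ∈ U) (h2 : ∀ z ∈ U, ‖fderiv ℝ (fderiv ℝ ψ) z‖ ≤ C₂)
    (h3 : ∀ z ∈ U, ‖fderiv ℝ (fderiv ℝ (fderiv ℝ ψ)) z‖ ≤ C₃) :
    ‖fderiv ℝ (fun y ↦ ψ (y + A y) - ψ y - fderiv ℝ ψ y (A y)) x‖ ≤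
      C₃ * ‖A x‖ ^ 2 + C₂ * ‖A‖ * ‖A x‖ := by
  rw [(hasFDerivAt_rem hUo hψ hx hAx).fderiv, fderiv_fderiv_flip_apply hUo hψ hx]
  have key : (fderiv ℝ ψ (x + A x)).comp (ContinuousLinearMap.id ℝ E + A) - fderiv ℝ ψ x
        - ((fderiv ℝ ψ x).comp A + fderiv ℝ (fderiv ℝ ψ) x (A x)) =
      (fderiv ℝ ψ (x + A x) - fderiv ℝ ψ x - fderiv ℝ (fderiv ℝ ψ) x (A x))
        + (fderiv ℝ ψ (x + A x) - fderiv ℝ ψ x).comp A := by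
    rw [ContinuousLinearMap.comp_add, ContinuousLinearMap.comp_id, ContinuousLinearMap.sub_comp]
    abel
  rw [key]
  have t1 : ‖fderiv ℝ ψ (x + A x) - fderiv ℝ ψ x - fderiv ℝ (fderiv ℝ ψ) x (A x)‖ ≤
      C₃ * ‖A x‖ ^ 2 :=
    norm_taylor₂_le hUc (fun _ hz ↦ (hasFDerivAt_fderiv_of_mem hUo hψ hz).differentiableAt)
      (fun _ hz ↦ (hasFDerivAt_fderiv_of_mem hUo (contDiffOn_fderiv_of_isOpen hUo hψ)
        hz).differentiableAt) h3 hx hAx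
  have t2 : ‖(fderiv ℝ ψ (x + A x) - fderiv ℝ ψ x).comp A‖ ≤ C₂ * ‖A x‖ * ‖A‖ :=
    (opNorm_comp_le _ _).trans (mul_le_mul_of_nonneg_right
      (norm_fderiv_sub_le hUo hUc hψ hx hAx h2) (norm_nonneg _))
  calc _ ≤ C₃ * ‖A x‖ ^ 2 + C₂ * ‖A x‖ * ‖A‖ := norm_add_le_of_le t1 t2
    _ = _ := by ring

/-- **`‖DΔ(x)‖ ≤ C₂ ‖Ax‖ + C₁ ‖A‖`**: `DΔ(x) = (Dψ(x+Ax) − Dψ(x)) + Dψ(x+Ax) ∘ A`. [folklore] -/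
theorem norm_fderiv_delta_le (hUo : IsOpen U) (hUc : Convex ℝ U) (hψ : ContDiffOn ℝ ∞ ψ U)
    (hx : x ∈ U) (hAx : x + A x ∈ U) (h1 : ∀ z ∈ U, ‖fderiv ℝ ψ z‖ ≤ C₁)
    (h2 : ∀ z ∈ U, ‖fderiv ℝ (fderiv ℝ ψ) z‖ ≤ C₂) :
    ‖fderiv ℝ (fun y ↦ ψ (y + A y) - ψ y) x‖ ≤ C₂ * ‖A x‖ + C₁ * ‖A‖ := by
  rw [(hasFDerivAt_delta hUo hψ hx hAx).fderiv]
  have key : (fderiv ℝ ψ (x + A x)).comp (ContinuousLinearMap.id ℝ E + A) - fderiv ℝ ψ x =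
      (fderiv ℝ ψ (x + A x) - fderiv ℝ ψ x) + (fderiv ℝ ψ (x + A x)).comp A := by
    rw [ContinuousLinearMap.comp_add, ContinuousLinearMap.comp_id]
    abel
  rw [key]
  have t2 : ‖(fderiv ℝ ψ (x + A x)).comp A‖ ≤ C₁ * ‖A‖ :=
    (opNorm_comp_le _ _).trans (mul_le_mul_of_nonneg_right (h1 _ hAx) (norm_nonneg _))
  exact norm_add_le_of_le (norm_fderiv_sub_le hUo hUc hψ hx hAx h2) t2

/-- **`‖D(ψ(· + A·))(x)‖ ≤ C₁ (1 + ‖A‖)`**. [folklore] -/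
theorem norm_fderiv_comp_affine_le (hUo : IsOpen U) (hψ : ContDiffOn ℝ ∞ ψ U) (hAx : x + A x ∈ U)
    (h1 : ∀ z ∈ U, ‖fderiv ℝ ψ z‖ ≤ C₁) :
    ‖fderiv ℝ (fun y ↦ ψ (y + A y)) x‖ ≤ C₁ * (1 + ‖A‖) := by
  rw [(hasFDerivAt_comp_affine hUo hψ hAx).fderiv]
  have hC₁ : 0 ≤ C₁ := (norm_nonneg _).trans (h1 _ hAx)
  have hid : ‖ContinuousLinearMap.id ℝ E + A‖ ≤ 1 + ‖A‖ :=
    (norm_add_le (ContinuousLinearMap.id ℝ E) A).trans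
      (add_le_add ContinuousLinearMap.norm_id_le le_rfl)
  calc _ ≤ ‖fderiv ℝ ψ (x + A x)‖ * ‖ContinuousLinearMap.id ℝ E + A‖ := opNorm_comp_le _ _
    _ ≤ C₁ * (1 + ‖A‖) :=
        mul_le_mul (h1 _ hAx) hid (norm_nonneg _) hC₁

end Remainders


/-- **Registered sub-goal form** (stub `dragDefect_taylor_fderiv_rem` of the crux item) of
`norm_fderiv_rem_le`. [folklore] -/
theorem dragDefect_taylor_fderiv_rem : ∀ {E G : Type*} [NormedAddCommGroup E] [NormedSpace ℝ E] [NormedAddCommGroup G] [NormedSpace ℝ G] {ψ : E → G} {U : Set E} {A : E →L[ℝ] E} {x : E} {C₂ C₃ : ℝ}, IsOpen U → Convex ℝ U → ContDiffOn ℝ ((⊤ : ℕ∞) : WithTop ℕ∞) ψ U → x ∈ U → x + A x ∈ U → (∀ z ∈ U, ‖fderiv ℝ (fderiv ℝ ψ) z‖ ≤ C₂) → (∀ z ∈ U, ‖fderiv ℝ (fderiv ℝ (fderiv ℝ ψ)) z‖ ≤ C₃) → ‖fderiv ℝ (fun y ↦ ψ (y + A y) - ψ y - fderiv ℝ ψ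 y (A y)) x‖ ≤ C₃ * ‖A x‖ ^ 2 + C₂ * ‖A‖ * ‖A x‖ :=
  fun hUo hUc hψ hx hAx h2 h3 ↦ norm_fderiv_rem_le hUo hUc hψ hx hAx h2 h3

end DragDefect

end Summit.FinalStateConjecture.FinalStateConjecture.Theorems

end
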